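import Summits.QuantumFields.YangMills.Theorems.ColdStartUniversalityLatticeLangevinHaarSpectralGap
import Summits.QuantumFields.YangMills.Theorems.ColdStartUniversalityLatticeLangevinWilsonHolleyStroock
import Summits.QuantumFields.YangMills.Theorems.ColdStartUniversalityLatticeLangevinWilsonSpectralGapColdStartEvents
import HarnessLib

/-!
# Route `ColdStartUniversality` (fixed-cut-off `L²(μ_{β'})` package): ★★ the first EXPLICIT `L²(μ_{β'})` spectral gap of the
# SU(2) lattice Langevin dynamics — `λ(L, β') = (3/2)·e^{−4|β'|·#𝒫}` at EVERY torus size `L` and coupling `β'`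

Helper file (seat `ym-line-csu-p1`, g19; `--supports stmt-QuantumFields-27363`).  Assembly of
* `haar_generatorPoincare` (`…HaarSpectralGap`): generator-form Poincaré with the sharp constant `3/2` for product Haar measure;
* `generatorPoincare_holleyStroock` (`…WilsonHolleyStroock`): transfer to `μ_{β'}` at the price `e^{−|β'|·osc S} ≥ e^{−4|β'|#𝒫}`;
* `integral_sq_transition_sub_le_exp_of_generatorPoincare` (g18, `…WilsonGeneratorPoincare`): generator-form Poincaré(`λ`) ⇒
  `L²(μ_{β'})` decay at rate `λ` for every realising kernel family and every continuous observable (no core / ESA input);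
* `integral_sq_transition_sub_le_exp_of_measurable` (g16): extension to bounded measurable observables.

Results (`λ(L,β') := (3/2)·exp(−|β'|·4·#𝒫)`, `#𝒫 = Fintype.card (Plaquette 3 L) = 3L³`):
* ★★ `wilson_generatorPoincare_explicit` — `λ(L,β') Var_{μ_{β'}}(F) ≤ −∫ (F − μF) 𝓛_{β'}f dμ_{β'}` for every `C³` cylinder `F`;
* ★★ `wilson_spectralGap_explicit` — `∫ (κ_t G − μG)² dμ_{β'} ≤ e^{−2λ(L,β')t} Var_{μ_{β'}}(G)` for every realising kernel family,
  every continuous `G`, every `t` — g16's `wilson_spectralGap` (EXISTENTIAL Doeblin constant) with an explicit rate;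
* ★ `wilson_spectralGap_explicit_measurable` — the same for bounded measurable `G`;
* `wilson_explicitGap_pos`, `wilson_explicitGap_le` — `0 < λ(L,β') ≤ 3/2`, with equality at `β' = 0` where it is sharp
  (`integral_sq_transition_sub_eq_beta_zero_degree_one`);
* ★ `coldStart_measurable_sq_sub_le_exp_explicit` — COLD-START mixing with the explicit rate: from any deterministic start `z`, after a
  burn-in `t₁ > 0` (density constant `D = D(L,β',z,t₁)`, still existential), for every solution on any space,
  `(E F(U_{t₁+t}) − μF)² ≤ D e^{−2λ(L,β')t} Var_μ(F)` (bounded measurable `F`) and `(P(U_{t₁+t} ∈ A) − μ(A))² ≤ D e^{−2λ(L,β')t} μ(A)(1−μ(A))`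
  — g16's `coldStart_measurable_sq_sub_le_exp` with the rate made explicit (the quantitative form of the rung `stub_fixedCutoffMixing`
  in `L²`, at fixed cut-off).

THEOREMS ONLY, no definition, no sorry.  HONEST FRAMING: RECORD-rung R3 plumbing at FIXED cut-off.  In the route's scaling
`β' = (γ ε_K)⁻¹/2`, `L = L_K`, the rate `λ(L_K, β'_K) ~ e^{−6 L_K³/(γ ε_K)}` (lattice units) is astronomically far from the cut-off-uniform
physical-units gap `(H1)`/`(G)` that the crux asks for — this file quantifies the generic (Holley–Stroock) bound and nothing more; the
true finite-volume gap at large `β'` is governed by the flat directions of `S` and is not exponentially small, but no such bound is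
claimed here.  Nothing K-uniform is proved; no crux, rung or summit statement is proved; the Yang–Mills mass gap is NOT proved.
-/

set_option autoImplicit false

noncomputable section

namespace Summit.QuantumFields.YangMills.Theorems.ColdStartUniversality

open MeasureTheory ProbabilityTheory Finset Filter Set Topology
open scoped BigOperators NNReal ENNReal
open Literature.Probability.Process Literature.MathematicalPhysics.QuantumFieldTheory
open Literature.MathematicalPhysics.QuantumLattice (fundamentalRep fundamentalLatticeRep continuous_fundamentalRep)

variable {L : ℕ} [NeZero L]

/-- The explicit rate `λ(L,β') = (3/2)·e^{−4|β'|#𝒫}` is positive. [folklore] -/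
theorem wilson_explicitGap_pos (L : ℕ) [NeZero L] (β' : ℝ) :
    0 < (3 / 2 : ℝ) * Real.exp (-(|β'| * (4 * (Fintype.card (Plaquette 3 L) : ℝ)))) := by
  positivity

/-- The explicit rate `λ(L,β') ≤ 3/2 = λ(L,0)`, the sharp gap of the `β' = 0` dynamics. [folklore] -/
theorem wilson_explicitGap_le (L : ℕ) [NeZero L] (β' : ℝ) :
    (3 / 2 : ℝ) * Real.exp (-(|β'| * (4 * (Fintype.card (Plaquette 3 L) : ℝ)))) ≤ 3 / 2 := by
  have h : Real.exp (-(|β'| * (4 * (Fintype.card (Plaquette 3 L) : ℝ)))) ≤ 1 :=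
    Real.exp_le_one_iff.2 (by
      have : 0 ≤ |β'| * (4 * (Fintype.card (Plaquette 3 L) : ℝ)) := by positivity
      linarith)
  nlinarith

/-- ★★ **Explicit generator-form Poincaré inequality for the Wilson measure `μ_{β'}` of `SU(2)` lattice gauge theory on `(ℤ/L)³`**:
for every `C³` function `f` of the real link coordinates, `F = f∘coords`, `m = μ_{β'}F`,
`(3/2) e^{−4|β'|#𝒫} ∫ (F − m)² dμ_{β'} ≤ −∫ (F − m) 𝓛_{β'}f dμ_{β'}` (`𝓛_{β'}` = the SZZ coordinate generator).
Sharp Haar constant `3/2` (`haar_generatorPoincare`) + Holley–Stroock (`generatorPoincare_holleyStroock`).  Compare g16's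
`wilson_poincare` (existential constant from the Doeblin minorisation). [cite: HolleyStroock1987] -/
theorem wilson_generatorPoincare_explicit (L : ℕ) [NeZero L] (β' : ℝ)
    (f : (Edge 3 L × Fin 2 × Fin 2 × Bool → ℝ) → ℝ) (hf : ContDiff ℝ 3 f) :
    let coords : GaugeConfig 3 L (Matrix.specialUnitaryGroup (Fin 2) ℂ) → (Edge 3 L × Fin 2 × Fin 2 × Bool → ℝ) :=
      fun V q => (fun z : ℂ => if q.2.2.2 then z.im else z.re)
        ((fundamentalRep (Fin 2) (V q.1) : Matrix (Fin 2) (Fin 2) ℂ) q.2.1 q.2.2.1)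
    let gen : GaugeConfig 3 L (Matrix.specialUnitaryGroup (Fin 2) ℂ) → ℝ := fun V =>
      (∑ i : Edge 3 L × Fin 2 × Fin 2 × Bool, fderiv ℝ f (coords V) (Pi.single i 1) *
          (fun z : ℂ => if i.2.2.2 then z.im else z.re)
            ((latticeLangevinDynamics (fundamentalLatticeRep 2) β').drift
              (matrixConfig (fundamentalRep (Fin 2)) V) i.1 i.2.1 i.2.2.1) +
      1 / 2 * ∑ i : Edge 3 L × Fin 2 × Fin 2 × Bool, ∑ j : Edge 3 L × Fin 2 × Fin 2 × Bool,
        fderiv ℝ (fun z => fderiv ℝ f z (Pi.single i 1)) (coords V) (Pi.single j 1) *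
          ∑ n : Edge 3 L × NoiseIdx 2,
            (if n.1 = i.1 then (fun z : ℂ => if i.2.2.2 then z.im else z.re)
              ((latticeLangevinDynamics (fundamentalLatticeRep 2) β').noise
                (matrixConfig (fundamentalRep (Fin 2)) V) i.1 n.2 i.2.1 i.2.2.1) else 0) *
            (if n.1 = j.1 then (fun z : ℂ => if j.2.2.2 then z.im else z.re)
              ((latticeLangevinDynamics (fundamentalLatticeRep 2) β').noise
                (matrixConfig (fundamentalRep (Fin 2)) V) j.1 n.2 j.2.1 j.2.2.1) else 0))
    (3 / 2 : ℝ) * Real.exp (-(|β'| * (4 * (Fintype.card (Plaquette 3 L) : ℝ)))) *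
        ∫ V, (f (coords V) - ∫ V', f (coords V') ∂(wilsonMeasure (d := 3) (L := L) (fundamentalRep (Fin 2)) β')) ^ 2
          ∂(wilsonMeasure (d := 3) (L := L) (fundamentalRep (Fin 2)) β') ≤
      -∫ V, (f (coords V) - ∫ V', f (coords V') ∂(wilsonMeasure (d := 3) (L := L) (fundamentalRep (Fin 2)) β')) *
        gen V ∂(wilsonMeasure (d := 3) (L := L) (fundamentalRep (Fin 2)) β') :=
  generatorPoincare_holleyStroock L β' (lam0 := 3 / 2) (by norm_num) (fun g hg => haar_generatorPoincare L g hg) f hf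

/-- ★★ **THE EXPLICIT `L²(μ_{β'})` SPECTRAL GAP of the SU(2) lattice Langevin dynamics at every fixed cut-off.**  For every torus size
`L`, coupling `β'`, every Markov kernel family `κ` realising the SZZ transition laws, every continuous `G` and every lattice time `t`:
`∫ (κ_t G − μG)² dμ_{β'} ≤ exp(−2·(3/2)e^{−4|β'|#𝒫}·t) · ∫ (G − μG)² dμ_{β'}`.  g16's `wilson_spectralGap` had `∃ c > 0`; here
`c = λ(L,β') = (3/2) e^{−4|β'|#𝒫}` (explicit Poincaré + g18's `integral_sq_transition_sub_le_exp_of_generatorPoincare`).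
[cite: BakryGentilLedoux2014, Thm 4.2.5] [cite: HolleyStroock1987] -/
theorem wilson_spectralGap_explicit (L : ℕ) [NeZero L] (β' : ℝ)
    (κ : ℝ≥0 → Kernel (GaugeConfig 3 L (Matrix.specialUnitaryGroup (Fin 2) ℂ))
      (GaugeConfig 3 L (Matrix.specialUnitaryGroup (Fin 2) ℂ))) [∀ t, IsMarkovKernel (κ t)]
    (hreal : ∀ (t : ℝ≥0) (x : GaugeConfig 3 L (Matrix.specialUnitaryGroup (Fin 2) ℂ))
        (Ω : Type) [MeasurableSpace Ω] (P : Measure Ω) [IsProbabilityMeasure P]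
        (W : ℝ≥0 → Ω → (Edge 3 L × NoiseIdx 2 → ℝ)) (hW : IsFlatBrownian W P)
        (U : ℝ≥0 → Ω → GaugeConfig 3 L (Matrix.specialUnitaryGroup (Fin 2) ℂ)),
        (∀ ω, U 0 ω = x) →
        (latticeLangevinDynamics (fundamentalLatticeRep 2) β').IsSolution (fundamentalRep (Fin 2))
          hW.natFiltration P W U →
        κ t x = P.map (U t))
    {G : GaugeConfig 3 L (Matrix.specialUnitaryGroup (Fin 2) ℂ) → ℝ} (hG : Continuous G) (t : ℝ≥0) :
    ∫ x, ((∫ y, G y ∂(κ t x)) - ∫ z, G z ∂(wilsonMeasure (d := 3) (L := L) (fundamentalRep (Fin 2)) β')) ^ 2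
        ∂(wilsonMeasure (d := 3) (L := L) (fundamentalRep (Fin 2)) β') ≤
      Real.exp (-2 * ((3 / 2 : ℝ) * Real.exp (-(|β'| * (4 * (Fintype.card (Plaquette 3 L) : ℝ))))) * t) *
        ∫ x, (G x - ∫ z, G z ∂(wilsonMeasure (d := 3) (L := L) (fundamentalRep (Fin 2)) β')) ^ 2
          ∂(wilsonMeasure (d := 3) (L := L) (fundamentalRep (Fin 2)) β') :=
  integral_sq_transition_sub_le_exp_of_generatorPoincare L β' κ hreal
    (lam := (3 / 2 : ℝ) * Real.exp (-(|β'| * (4 * (Fintype.card (Plaquette 3 L) : ℝ)))))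
    (fun f hf => wilson_generatorPoincare_explicit L β' f hf) hG t

/-- ★ **The explicit spectral gap on bounded measurable observables**: the same decay, same explicit rate, for every bounded
measurable `G` (g16's bridge `integral_sq_transition_sub_le_exp_of_measurable`).  In particular for an event `A`,
`∫ (κ_t(x,A) − μ(A))² dμ_{β'}(x) ≤ e^{−2λ(L,β')t} μ(A)(1 − μ(A))`. [cite: RobertsRosenthal1997, Theorem 2.1] -/
theorem wilson_spectralGap_explicit_measurable (L : ℕ) [NeZero L] (β' : ℝ)
    (κ : ℝ≥0 → Kernel (GaugeConfig 3 L (Matrix.specialUnitaryGroup (Fin 2) ℂ))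
      (GaugeConfig 3 L (Matrix.specialUnitaryGroup (Fin 2) ℂ))) [∀ t, IsMarkovKernel (κ t)]
    (hreal : ∀ (t : ℝ≥0) (x : GaugeConfig 3 L (Matrix.specialUnitaryGroup (Fin 2) ℂ))
        (Ω : Type) [MeasurableSpace Ω] (P : Measure Ω) [IsProbabilityMeasure P]
        (W : ℝ≥0 → Ω → (Edge 3 L × NoiseIdx 2 → ℝ)) (hW : IsFlatBrownian W P)
        (U : ℝ≥0 → Ω → GaugeConfig 3 L (Matrix.specialUnitaryGroup (Fin 2) ℂ)),
        (∀ ω, U 0 ω = x) →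
        (latticeLangevinDynamics (fundamentalLatticeRep 2) β').IsSolution (fundamentalRep (Fin 2))
          hW.natFiltration P W U →
        κ t x = P.map (U t))
    {G : GaugeConfig 3 L (Matrix.specialUnitaryGroup (Fin 2) ℂ) → ℝ} (hG : Measurable G) {M : ℝ} (hM : ∀ x, |G x| ≤ M)
    (t : ℝ≥0) :
    ∫ x, ((∫ y, G y ∂(κ t x)) - ∫ z, G z ∂(wilsonMeasure (d := 3) (L := L) (fundamentalRep (Fin 2)) β')) ^ 2
        ∂(wilsonMeasure (d := 3) (L := L) (fundamentalRep (Fin 2)) β') ≤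
      Real.exp (-2 * ((3 / 2 : ℝ) * Real.exp (-(|β'| * (4 * (Fintype.card (Plaquette 3 L) : ℝ))))) * t) *
        ∫ x, (G x - ∫ z, G z ∂(wilsonMeasure (d := 3) (L := L) (fundamentalRep (Fin 2)) β')) ^ 2
          ∂(wilsonMeasure (d := 3) (L := L) (fundamentalRep (Fin 2)) β') :=
  integral_sq_transition_sub_le_exp_of_measurable L β' κ hreal
    (fun _ hG' => wilson_spectralGap_explicit L β' κ hreal hG' t) hG hM


/-! ## ★ Cold-start mixing with the explicit rate -/

/-- ★ **Cold-start `L²` mixing of the SZZ dynamics with the EXPLICIT rate `λ(L,β') = (3/2)e^{−4|β'|#𝒫}`.**  For every deterministic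
start `z` and burn-in `t₁ > 0` there is `D ≥ 0` (the density bound of the law at time `t₁`, times the Haar/Wilson comparison constant)
such that for EVERY solution from `z` on ANY filtered probability space: (i) for every bounded measurable `F` and every `t`,
`(∫ F(U_{t₁+t}) dP − μ_{β'}F)² ≤ D e^{−2λ(L,β')t} Var_{μ_{β'}}(F)`; (ii) for every measurable `A` and every `t`,
`(law(U_{t₁+t})(A) − μ_{β'}(A))² ≤ D e^{−2λ(L,β')t} μ_{β'}(A)(1 − μ_{β'}(A))`.  g16's `coldStart_measurable_sq_sub_le_exp` with the existential
Doeblin rate replaced by the explicit one (`wilson_spectralGap_explicit_measurable`); same proof (Chapman–Kolmogorov, Jensen against the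
dominated law at time `t₁`). [cite: RobertsRosenthal1997, Theorem 2.1] [cite: HolleyStroock1987] -/
theorem coldStart_measurable_sq_sub_le_exp_explicit (L : ℕ) [NeZero L] (β' : ℝ)
    (z : GaugeConfig 3 L (Matrix.specialUnitaryGroup (Fin 2) ℂ)) (t₁ : ℝ≥0) (ht₁ : 0 < (t₁ : ℝ)) :
    ∃ D : ℝ, 0 ≤ D ∧
      ∀ (Ω : Type) [MeasurableSpace Ω] (P : Measure Ω) [IsProbabilityMeasure P]
        (W : ℝ≥0 → Ω → (Edge 3 L × NoiseIdx 2 → ℝ)) (hW : IsFlatBrownian W P)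
        (U : ℝ≥0 → Ω → GaugeConfig 3 L (Matrix.specialUnitaryGroup (Fin 2) ℂ)),
        (∀ ω, U 0 ω = z) →
        (latticeLangevinDynamics (fundamentalLatticeRep 2) β').IsSolution (fundamentalRep (Fin 2))
          hW.natFiltration P W U →
        (∀ (F : GaugeConfig 3 L (Matrix.specialUnitaryGroup (Fin 2) ℂ) → ℝ), Measurable F →
          ∀ M : ℝ, (∀ x, |F x| ≤ M) → ∀ t : ℝ≥0,
          ((∫ ω, F (U (t₁ + t) ω) ∂P) - ∫ x, F x ∂(wilsonMeasure (d := 3) (L := L) (fundamentalRep (Fin 2)) β')) ^ 2 ≤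
            D * Real.exp (-2 * ((3 / 2 : ℝ) * Real.exp (-(|β'| * (4 * (Fintype.card (Plaquette 3 L) : ℝ))))) * t) *
              ∫ x, (F x - ∫ z, F z ∂(wilsonMeasure (d := 3) (L := L) (fundamentalRep (Fin 2)) β')) ^ 2
                ∂(wilsonMeasure (d := 3) (L := L) (fundamentalRep (Fin 2)) β')) ∧
        (∀ (A : Set (GaugeConfig 3 L (Matrix.specialUnitaryGroup (Fin 2) ℂ))), MeasurableSet A → ∀ t : ℝ≥0,
          ((P.map (U (t₁ + t))).real A - (wilsonMeasure (d := 3) (L := L) (fundamentalRep (Fin 2)) β').real A) ^ 2 ≤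
            D * Real.exp (-2 * ((3 / 2 : ℝ) * Real.exp (-(|β'| * (4 * (Fintype.card (Plaquette 3 L) : ℝ))))) * t) *
              ((wilsonMeasure (d := 3) (L := L) (fundamentalRep (Fin 2)) β').real A *
                (1 - (wilsonMeasure (d := 3) (L := L) (fundamentalRep (Fin 2)) β').real A))) := by
  classical
  haveI := secondCountableTopology_su2
  haveI := borelSpace_config L
  haveI : IsProbabilityMeasure (wilsonMeasure (d := 3) (L := L) (fundamentalRep (Fin 2)) β') :=
    isProbabilityMeasure_wilsonMeasure (d := 3) (L := L) (fundamentalRep (Fin 2)) (continuous_fundamentalRep (Fin 2)) β'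
  set c : ℝ := (3 / 2 : ℝ) * Real.exp (-(|β'| * (4 * (Fintype.card (Plaquette 3 L) : ℝ)))) with hc
  set μ : Measure (GaugeConfig 3 L (Matrix.specialUnitaryGroup (Fin 2) ℂ)) :=
    wilsonMeasure (d := 3) (L := L) (fundamentalRep (Fin 2)) β' with hμ
  -- THE kernels and the density bound at time `t₁`
  obtain ⟨κ, hκ, -, hreal⟩ := exists_transitionKernel L β'
  haveI := hκ
  obtain ⟨a, ha, -, hπle⟩ := wilsonMeasure_le_smul_pi_haar_and (L := L) β'
  haveI := isProbabilityMeasure_piWiener (Edge 3 L × NoiseIdx 2)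
  have hWc := isFlatBrownian_piWiener 3 L (NoiseIdx 2)
  obtain ⟨Uc, hUc0, hUc⟩ := solution_from_start hWc β' z
  obtain ⟨C₁, hC₁, hle₁⟩ := map_le_smul_haar (L := L) β' ht₁ z hWc hUc0 hUc
  have hκle : κ t₁ z ≤ (ENNReal.ofReal (C₁ * a)) • μ := by
    rw [hreal t₁ z _ _ _ hWc Uc hUc0 hUc, ENNReal.ofReal_mul hC₁, Measure.le_iff]
    intro A hA
    have e1 := Measure.le_iff.1 hle₁ A hA
    have e2 := Measure.le_iff.1 hπle A hA
    simp only [Measure.smul_apply, smul_eq_mul] at e1 e2 ⊢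
    calc (Measure.map (Uc t₁) (Measure.pi fun _ : Edge 3 L × NoiseIdx 2 => preWienerMeasure)) A
        ≤ ENNReal.ofReal C₁ * (Measure.pi fun _ : Edge 3 L => haarProbability (Matrix.specialUnitaryGroup (Fin 2) ℂ)) A := e1
      _ ≤ ENNReal.ofReal C₁ * (ENNReal.ofReal a * μ A) := mul_le_mul' le_rfl e2
      _ = ENNReal.ofReal C₁ * ENNReal.ofReal a * μ A := (mul_assoc _ _ _).symm
  refine ⟨C₁ * a, by positivity, fun Ω _ P _ W hW U hU0 hU => ?_⟩
  -- (i) bounded measurable observables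
  have hobs : ∀ (F : GaugeConfig 3 L (Matrix.specialUnitaryGroup (Fin 2) ℂ) → ℝ), Measurable F →
      ∀ M : ℝ, (∀ x, |F x| ≤ M) → ∀ t : ℝ≥0,
      ((∫ ω, F (U (t₁ + t) ω) ∂P) - ∫ x, F x ∂μ) ^ 2 ≤
        C₁ * a * Real.exp (-2 * c * t) * ∫ x, (F x - ∫ z, F z ∂μ) ^ 2 ∂μ := by
    intro F hF M hM t
    have hFi : ∀ (ν : Measure (GaugeConfig 3 L (Matrix.specialUnitaryGroup (Fin 2) ℂ))) [IsProbabilityMeasure ν],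
        Integrable F ν := fun ν _ => integrable_of_abs_le ν hF hM
    have hmU : Measurable (U (t₁ + t)) := (hU.adapted (t₁ + t)).mono (hW.natFiltration.le (t₁ + t)) le_rfl
    have hE : ∫ ω, F (U (t₁ + t) ω) ∂P = ∫ y, (∫ y', F y' ∂(κ t y)) ∂(κ t₁ z) := by
      rw [← integral_map hmU.aemeasurable hF.aestronglyMeasurable, ← hreal (t₁ + t) z Ω P W hW U hU0 hU,
        chapmanKolmogorov_szz β' κ hreal t₁ t]
      haveI : IsProbabilityMeasure ((κ t ∘ₖ κ t₁) z) := by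
        rw [← chapmanKolmogorov_szz β' κ hreal t₁ t]; infer_instance
      exact Kernel.integral_comp (hFi _)
    set m : ℝ := ∫ x, F x ∂μ with hm
    have hκFm : Measurable fun y => ∫ y', F y' ∂(κ t y) := (hF.stronglyMeasurable.integral_kernel (κ := κ t)).measurable
    have hκFb : ∀ y, |(∫ y', F y' ∂(κ t y)) - m| ≤ M + M := fun y =>
      (abs_sub _ _).trans (add_le_add (abs_integral_le_of_abs_le_of_isProbabilityMeasure hM)
        (abs_integral_le_of_abs_le_of_isProbabilityMeasure hM))
    have hcent : (∫ ω, F (U (t₁ + t) ω) ∂P) - m = ∫ y, ((∫ y', F y' ∂(κ t y)) - m) ∂(κ t₁ z) := by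
      rw [hE, integral_sub (integrable_of_abs_le _ hκFm (C := M)
        fun y => abs_integral_le_of_abs_le_of_isProbabilityMeasure hM) (integrable_const m)]
      simp
    rw [hcent]
    have hJ := sq_integral_le_mul_integral_sq_of_measurable (by positivity : (0 : ℝ) ≤ C₁ * a) hκle
      (hκFm.sub measurable_const) hκFb
    have hvar := wilson_spectralGap_explicit_measurable L β' κ hreal hF hM t
    calc (∫ y, ((∫ y', F y' ∂(κ t y)) - m) ∂(κ t₁ z)) ^ 2
        ≤ (C₁ * a) * ∫ y, ((∫ y', F y' ∂(κ t y)) - m) ^ 2 ∂μ := hJ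
      _ ≤ (C₁ * a) * (Real.exp (-2 * c * t) * ∫ x, (F x - m) ^ 2 ∂μ) :=
          mul_le_mul_of_nonneg_left hvar (by positivity)
      _ = C₁ * a * Real.exp (-2 * c * t) * ∫ x, (F x - m) ^ 2 ∂μ := by ring
  refine ⟨hobs, fun A hA t => ?_⟩
  -- (ii) events: `F = 1_A`
  have h1A : ∀ x : GaugeConfig 3 L (Matrix.specialUnitaryGroup (Fin 2) ℂ),
      |A.indicator (1 : GaugeConfig 3 L (Matrix.specialUnitaryGroup (Fin 2) ℂ) → ℝ) x| ≤ 1 := by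
    intro x
    by_cases hx : x ∈ A
    · simp [Set.indicator_of_mem hx]
    · simp [Set.indicator_of_notMem hx]
  have h := hobs (A.indicator (1 : GaugeConfig 3 L (Matrix.specialUnitaryGroup (Fin 2) ℂ) → ℝ))
    (measurable_one.indicator hA) 1 h1A t
  have hmU : Measurable (U (t₁ + t)) := (hU.adapted (t₁ + t)).mono (hW.natFiltration.le (t₁ + t)) le_rfl
  have e1 : ∫ ω, A.indicator (1 : GaugeConfig 3 L (Matrix.specialUnitaryGroup (Fin 2) ℂ) → ℝ) (U (t₁ + t) ω) ∂P =
      (P.map (U (t₁ + t))).real A := by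
    rw [← integral_map hmU.aemeasurable ((measurable_one.indicator hA).aestronglyMeasurable), integral_indicator_one hA]
  rw [e1, integral_indicator_one hA, integral_indicator_sub_sq _ hA] at h
  exact h

end Summit.QuantumFields.YangMills.Theorems.ColdStartUniversality

end
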